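import Mathlib.RingTheory.Flat.FaithfullyFlat.Algebra
import Mathlib.RingTheory.QuasiFinite.Basic
import Mathlib.RingTheory.Ideal.KrullsHeightTheorem
import Mathlib.RingTheory.KrullDimension.Zero
import Mathlib.RingTheory.LocalRing.Quotient
import Mathlib.RingTheory.LocalRing.ResidueField.Basic
import Mathlib.RingTheory.Spectrum.Prime.Noetherian
import HarnessLib

/-!
# A flat quasi-finite local homomorphism is a chart (crux `FrobeniusLadder.FRationalModification`, line `Sketch`)

Stub `stub_localChart` of the skeleton `Sketch` for crux stmt-ResolutionOfSingularities-15316.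
Let `R → S` be a local homomorphism of Noetherian local rings with `S` flat and quasi-finite over
`R` (Mathlib `Algebra.QuasiFinite`: `κ(𝔭) ⊗[R] S` is finite over `κ(𝔭)` for every prime `𝔭` of
`R`; this is what the stalk map of a finite, or locally quasi-finite, flat morphism of locally
Noetherian schemes is). Then

* `S` is faithfully flat over `R` (flat + local, `Module.FaithfullyFlat.of_flat_of_isLocalHom`);
* `dim S = dim R`: the dimension formula `dim S = dim R + dim S/𝔪_R S` for flat local
  homomorphisms (Matsumura, *Commutative Ring Theory*, Thm. 15.1; EGA IV₂ Cor. (6.1.2); here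
  from Mathlib's height form `Ideal.height_eq_height_add_of_liesOver_of_hasGoingDown`,
  Stacks 00ON), together with `dim S/𝔪_R S = 0`: the closed fibre `S/𝔪_R S` is quasi-finite,
  hence finite, over the residue field `R/𝔪_R`, hence Artinian;
* `𝔪_S ⊆ rad(𝔪_R S)`: the maximal ideal of the Artinian local ring `S/𝔪_R S` is nilpotent
  (`IsLocalRing.exists_maximalIdeal_pow_le_of_isArtinianRing_quotient`).

These are exactly the chart hypotheses of the flat-descent lemma `stub_flatDescent`
(`Theorems/FrobeniusLadderFRationalModificationFlatDescent`).
-/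

-- the problem path `ResolutionOfSingularities/ResolutionOfSingularities` forces a duplicated segment
set_option linter.dupNamespace false

namespace Summit.ResolutionOfSingularities.ResolutionOfSingularities.Theorems.FRationalModification.LocalChart

open IsLocalRing

/-- **Dimension formula for flat local homomorphisms** (Matsumura, *Commutative Ring Theory*,
Thm. 15.1; EGA IV₂ Cor. (6.1.2)): for a local homomorphism `R → S` of Noetherian local rings with
`S` flat over `R`, `dim S = dim R + dim (S / 𝔪_R S)`. Derived from Mathlib's
`Ideal.height_eq_height_add_of_liesOver_of_hasGoingDown` (Stacks 00ON; flat ⇒ going down)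
applied to the maximal ideals.
[cite: Matsumura1987, Thm. 15.1] -/
theorem ringKrullDim_eq_add_ringKrullDim_fiber {R S : Type*} [CommRing R] [CommRing S]
    [IsLocalRing R] [IsLocalRing S] [IsNoetherianRing R] [IsNoetherianRing S] [Algebra R S]
    [IsLocalHom (algebraMap R S)] [Module.Flat R S] :
    ringKrullDim S =
      ringKrullDim R + ringKrullDim (S ⧸ (maximalIdeal R).map (algebraMap R S)) := by
  -- adapted from `Literature.AlgebraicGeometry.Motives.ringKrullDim_eq_add_of_flat_of_isLocalHom`
  set I : Ideal S := (maximalIdeal R).map (algebraMap R S) with hI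
  have hItop : I ≠ ⊤ := (map_maximalIdeal_lt_top (algebraMap R S)).ne
  haveI : Nontrivial (S ⧸ I) := Ideal.Quotient.nontrivial_iff.mpr hItop
  haveI := IsLocalRing.of_surjective' (Ideal.Quotient.mk I) Ideal.Quotient.mk_surjective
  have hmax : (maximalIdeal S).map (Ideal.Quotient.mk I) = maximalIdeal (S ⧸ I) :=
    map_maximalIdeal_of_surjective (Ideal.Quotient.mk I) Ideal.Quotient.mk_surjective
  have h := Ideal.height_eq_height_add_of_liesOver_of_hasGoingDown (maximalIdeal R) (maximalIdeal S)
  rw [← hI, hmax] at h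
  rw [← maximalIdeal_height_eq_ringKrullDim, ← maximalIdeal_height_eq_ringKrullDim,
    ← maximalIdeal_height_eq_ringKrullDim, h, WithBot.coe_add]

/-- The closed fibre `S / 𝔪_R S` of a quasi-finite local homomorphism `R → S` of local rings is an
Artinian ring: it is quasi-finite, hence module-finite, over the residue field `R / 𝔪_R`
(`Module.Finite.of_quasiFinite`, `IsArtinianRing.of_finite`). [folklore] -/
theorem isArtinianRing_fiber {R S : Type*} [CommRing R] [CommRing S] [IsLocalRing R]
    [Algebra R S] [Algebra.QuasiFinite R S] :
    IsArtinianRing (S ⧸ (maximalIdeal R).map (algebraMap R S)) := by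
  letI : Field (R ⧸ maximalIdeal R) := Ideal.Quotient.field (maximalIdeal R)
  haveI : Algebra.QuasiFinite (R ⧸ maximalIdeal R) (S ⧸ (maximalIdeal R).map (algebraMap R S)) :=
    Algebra.QuasiFinite.of_restrictScalars R _ _
  haveI : Module.Finite (R ⧸ maximalIdeal R) (S ⧸ (maximalIdeal R).map (algebraMap R S)) :=
    Module.Finite.of_quasiFinite
  exact IsArtinianRing.of_finite (R ⧸ maximalIdeal R) _

/-- STUB `stub_localChart` — **a flat quasi-finite local homomorphism of Noetherian local rings is
a chart.** Let `R → S` be a local homomorphism of Noetherian local rings with `S` flat and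
quasi-finite over `R` (Mathlib `Algebra.QuasiFinite`: `κ(𝔭) ⊗[R] S` finite over `κ(𝔭)` for every
prime `𝔭`; this is what the stalk map of a finite — or locally quasi-finite — flat morphism of
schemes is). Then `S` is faithfully flat over `R` (flat + local,
`Module.FaithfullyFlat.of_flat_of_isLocalHom`), `dim S = dim R` (Matsumura 15.1:
`dim S = dim R + dim S/𝔪_R S`, and the closed fibre `S/𝔪_R S` is finite over the field `R/𝔪_R`,
hence Artinian of dimension `0`), and `𝔪_S ⊆ rad(𝔪_R S)` (the maximal ideal of the Artinian local
ring `S/𝔪_R S` is nilpotent). [cite: Matsumura1987, Thm. 15.1; folklore] -/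
theorem stub_localChart {R S : Type*} [CommRing R] [CommRing S] [IsLocalRing R] [IsLocalRing S]
    [IsNoetherianRing R] [IsNoetherianRing S] [Algebra R S] [IsLocalHom (algebraMap R S)]
    [Module.Flat R S] [Algebra.QuasiFinite R S] :
    Module.FaithfullyFlat R S ∧ ringKrullDim S = ringKrullDim R ∧
      maximalIdeal S ≤ ((maximalIdeal R).map (algebraMap R S)).radical := by
  set I : Ideal S := (maximalIdeal R).map (algebraMap R S) with hI
  have hItop : I ≠ ⊤ := (map_maximalIdeal_lt_top (algebraMap R S)).ne
  haveI : Nontrivial (S ⧸ I) := Ideal.Quotient.nontrivial_iff.mpr hItop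
  haveI : IsArtinianRing (S ⧸ I) := isArtinianRing_fiber
  refine ⟨Module.FaithfullyFlat.of_flat_of_isLocalHom, ?_, fun x hx => ?_⟩
  · have h0 : ringKrullDim (S ⧸ I) = 0 :=
      ringKrullDimZero_iff_ringKrullDim_eq_zero.mp inferInstance
    rw [ringKrullDim_eq_add_ringKrullDim_fiber (R := R) (S := S), ← hI, h0, add_zero]
  · obtain ⟨n, hn⟩ := exists_maximalIdeal_pow_le_of_isArtinianRing_quotient I
    exact ⟨n, hn (Ideal.pow_mem_pow hx n)⟩

end Summit.ResolutionOfSingularities.ResolutionOfSingularities.Theorems.FRationalModification.LocalChart
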